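import Summits.Parity.GeneralizedHardyLittlewood.Theorems.DicksonFibrationDimOneDefs
import Summits.Parity.GeneralizedHardyLittlewood.Theorems.DicksonFibrationDimOneStubSieveCountAux1
import Summits.Parity.GeneralizedHardyLittlewood.Theorems.LeeYangFibresRelativeDimOneSingularTail
import Mathlib.Analysis.Complex.ExponentialBounds
import HarnessLib

/-!
# Route `DicksonFibration`, crux `DimOne` (stmt-Parity-0819), line `birth` (sieve-model reshape):
# the stub `stub_singularTail` — the singular product at the sieve level

We prove the registered stub `stub_singularTail : SingularTailAtLevel` of the skeleton of the crux `DimOne`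
(vocabulary file `Theorems/DicksonFibrationDimOneDefs.lean`): uniformly over non-degenerate systems `Ψ` of
`t` forms `ψ_i(m) = a_i m + b_i` with `‖Ψ‖_N ≤ L`,
`|∏_{p ≤ n} β_p(Ψ) − 𝔖(Ψ)| ≤ ε` and `∏_{p ≤ n} β_p(Ψ) ≤ ε N` for `N ≥ N₀(t, L, ε)`,
where `n = ⌊y⌋`, `y = y_N = N^{1/u}`, `u = u_N = ⌈√(log N)⌉`.

Proof (Green–Tao 2010, proof of Lemma 1.3, with the bookkeeping of the template
`TranslateAmplification.stub_singularTail`, file `Theorems/LeeYangFibresRelativeDimOneSingularTail.lean`,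
whose truncation `⌊log N/4⌋` is replaced by `n = ⌊N^{1/u}⌋` and whose relative error is made absolute by
the Mertens head bound):

* HEAD: `0 ≤ ∏_{p ≤ n} β_p ≤ (P/φ(P))^t ≤ (e⁵ log n)^t`, `P = ∏_{p ≤ n} p` (the main-term identity
  `(P/φ(P))^t V(n + 1) = ∏_{p ≤ n} β_p` with `0 ≤ V ≤ 1`, and Mertens `P/φ(P) ≤ e⁵ log n`; helper file
  `Theorems/DicksonFibrationDimOneStubSieveCountAux1.lean`, `weight_pow_mul_prod_eq`, `weight_le`);
* TAIL: for `x ≥ n`, `∏_{p ≤ x} β_p = (∏_{p ≤ n} β_p) · Q`, `Q = ∏_{n < p ≤ x} β_p`, and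
  `∑_{n < p ≤ x} |β_p − 1| ≤ σ := t²/n + (4t/n) · t² log(2L²N)/log n` (generic primes `T²/p²`, the
  `≤ t² log(2L²N)/log n` primes dividing a cross-discriminant `4t/p` each:
  `SingularTailProof.sum_abs_localFactor_sub_one_le`), so `|Q − 1| ≤ e^σ − 1 ≤ 2σ` (`σ ≤ 1`) and
  `|∏_{p ≤ x} β_p − ∏_{p ≤ n} β_p| ≤ 2σ (e⁵ log n)^t ≤ ε`; then `x → ∞` (Lemma 1.3,
  `tendsto_singularProductPartial_holds`);
* NUMERICS (`exists_tailThreshold`): `n ≥ y/2`, `y = exp(log N/u) ≥ exp(u/16)` (`u² ≤ 16 log N`),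
  `log(2L²N)/log n ≤ 2 log N` (`n ≥ 3`), so `2σ (e⁵ log N)^t ≤ 4(t² + 8t³)(e⁵)^t (log N)^{t+1} e^{−u/16} → 0`
  (`eventually_decay`) and `(e⁵ log N)^t ≤ (e⁵ log N)^t N^{1/4} ≤ ε N` (`eventually_pow_log_mul_rpow`).

References: B. Green, T. Tao, *Linear equations in primes*, Ann. of Math. 171 (2010), Lemma 1.3, (1.6)–(1.7)
[GreenTao2010]; H. Halberstam, H.-E. Richert, *Sieve Methods* (1974), §5.7 [HalberstamRichert1974].
-/

noncomputable section

open scoped BigOperators Topology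
open Finset Filter Literature.NumberTheory.Sieve
open Summit.Parity.GeneralizedHardyLittlewood.Theorems.AbsoluteUpgrade
open Summit.Parity.GeneralizedHardyLittlewood.Cruxes.RelativeDimOne.TranslateAmplification.SingularTailProof

namespace Summit.Parity.GeneralizedHardyLittlewood.Cruxes.DimOne.BirthSieve

variable {t : ℕ}

/-! ### The head bound (Mertens) -/

/-- **Head bound**: `∏_{p ≤ n} β_p(Ψ) ≤ (e⁵ log n)^t` for `n ≥ 2` (`∏_{p ≤ n} β_p = (P/φ(P))^t V` with
`0 ≤ V = ∏_{p ≤ n} (1 − ω_F(p)/p) ≤ 1`, `P = ∏_{p ≤ n} p`, and Mertens `P/φ(P) ≤ e⁵ log n`).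
[cite: GreenTao2010, (1.6)–(1.7)] -/
theorem singularProductPartial_le_log_pow (Ψ : Fin t → AffLinForm 1) {n : ℕ} (hn : 2 ≤ n) :
    singularProductPartial Ψ n ≤ (Real.exp 5 * Real.log n) ^ t := by
  have hmain := weight_pow_mul_prod_eq Ψ n
  set W := (primesProdBelow ((n + 1 : ℕ) : ℝ) : ℝ) /
    (Nat.totient (primesProdBelow ((n + 1 : ℕ) : ℝ)) : ℝ) with hW
  set V := ∏ p ∈ Nat.primesBelow ⌈((n + 1 : ℕ) : ℝ)⌉₊,
    (1 - (polyRootCountMod ![sysPoly Ψ] p : ℝ) / p) with hV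
  have hV1 : V ≤ 1 := prod_one_sub_rootCount_le_one (sysPoly Ψ) _
  have hW0 : 0 ≤ W := by rw [hW]; positivity
  have hWle : W ≤ Real.exp 5 * Real.log n := weight_le hn
  calc singularProductPartial Ψ n = W ^ t * V := hmain.symm
    _ ≤ W ^ t := mul_le_of_le_one_right (pow_nonneg hW0 t) hV1
    _ ≤ (Real.exp 5 * Real.log n) ^ t := pow_le_pow_left₀ hW0 hWle t

/-! ### The sieve level beats every power of `log N` -/

/-- `exp(u_N/16) ≤ y_N = exp(log N/u_N)` once `u_N ≥ 17` (`u_N = ⌈√(log N)⌉ < √(log N) + 1`, so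
`u_N² ≤ 16 log N`). [folklore] -/
theorem exp_roughExp_div_le_roughLevel {N : ℕ} (hN : (1 : ℝ) ≤ N) (hu : 17 ≤ roughExp N) :
    Real.exp ((1 : ℝ) / 16 * roughExp N) ≤ roughLevel N := by
  have hN0 : (0 : ℝ) < N := by linarith
  set s := Real.sqrt (Real.log N) with hs
  have hs0 : 0 ≤ s := Real.sqrt_nonneg _
  have hl0 : 0 ≤ Real.log N := Real.log_nonneg hN
  have hss : s ^ 2 = Real.log N := Real.sq_sqrt hl0
  have hu_lt : (roughExp N : ℝ) < s + 1 := Nat.ceil_lt_add_one hs0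
  have h17 : (17 : ℝ) ≤ roughExp N := by exact_mod_cast hu
  have hu0 : (0 : ℝ) < roughExp N := by linarith
  have hylog : roughLevel N = Real.exp (Real.log N / roughExp N) := by
    rw [roughLevel, Real.rpow_def_of_pos hN0, mul_one_div]
  rw [hylog, Real.exp_le_exp, le_div_iff₀ hu0]
  have h1 : (roughExp N : ℝ) ^ 2 < (s + 1) ^ 2 := pow_lt_pow_left₀ hu_lt hu0.le two_ne_zero
  nlinarith

/-! ### The threshold in `N` -/

/-- **The threshold `N₀(t, L, ε)`.** For `N ≥ N₀`, with `n = ⌊y_N⌋`: `N ≥ 1`, `n ≥ max(2, L, 2t)`,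
the tail bound `σ = t²/n + (4t/n) · t² log(2L²N)/log n` has `σ ≤ 1` and `2σ (e⁵ log n)^t ≤ ε`, and the
head bound has `(e⁵ log n)^t ≤ ε N`. [folklore] -/
theorem exists_tailThreshold (t L : ℕ) {ε : ℝ} (hε : 0 < ε) : ∃ N₀ : ℕ, ∀ N : ℕ, N₀ ≤ N →
    0 < N ∧ 2 ≤ ⌊roughLevel N⌋₊ ∧ L ≤ ⌊roughLevel N⌋₊ ∧ 2 * t ≤ ⌊roughLevel N⌋₊ ∧
      (t : ℝ) ^ 2 / (⌊roughLevel N⌋₊ : ℕ) + 4 * t / (⌊roughLevel N⌋₊ : ℕ) * ((t : ℝ) ^ 2 *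
        (Real.log ((2 * L ^ 2 * N : ℕ) : ℝ) / Real.log (⌊roughLevel N⌋₊ : ℕ))) ≤ 1 ∧
      2 * ((t : ℝ) ^ 2 / (⌊roughLevel N⌋₊ : ℕ) + 4 * t / (⌊roughLevel N⌋₊ : ℕ) * ((t : ℝ) ^ 2 *
        (Real.log ((2 * L ^ 2 * N : ℕ) : ℝ) / Real.log (⌊roughLevel N⌋₊ : ℕ)))) *
          (Real.exp 5 * Real.log (⌊roughLevel N⌋₊ : ℕ)) ^ t ≤ ε ∧
      (Real.exp 5 * Real.log (⌊roughLevel N⌋₊ : ℕ)) ^ t ≤ ε * N := by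
  have hc1 : (1 : ℝ) ≤ ((max (2 * L ^ 2) (2 * t) + 3 : ℕ) : ℝ) := by
    exact_mod_cast (by omega : 1 ≤ max (2 * L ^ 2) (2 * t) + 3)
  have hA1 : (0 : ℝ) ≤ Real.exp 5 ^ t := by positivity
  have hA2 : (0 : ℝ) ≤ 4 * ((t : ℝ) ^ 2 + 8 * (t : ℝ) ^ 3) * Real.exp 5 ^ t := by positivity
  have hε1 : 0 < min ε 1 := lt_min hε one_pos
  obtain ⟨N₀, hN₀⟩ := Filter.eventually_atTop.mp ((eventually_roughLevel _ hc1).and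
    ((eventually_decay (t + 1) hA2 hε1).and ((eventually_pow_log_mul_rpow t hA1 hε).and
      (eventually_ge_real (2 * (L : ℝ) ^ 2)))))
  refine ⟨N₀, fun N hN => ?_⟩
  obtain ⟨⟨hN1, hu17, hyc, -⟩, hdec, hpol, hNL⟩ := hN₀ N hN
  set u : ℕ := roughExp N with hu
  set y : ℝ := roughLevel N with hy
  set n : ℕ := ⌊y⌋₊ with hn
  have hN0 : (0 : ℝ) < N := by linarith
  have hNpos : 0 < N := by exact_mod_cast hN0
  have hnc : max (2 * L ^ 2) (2 * t) + 3 ≤ n := Nat.le_floor hyc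
  have hn3 : 3 ≤ n := le_trans (by omega) hnc
  have hnT : 2 * t ≤ n := le_trans (by omega) hnc
  have hnL : L ≤ n := by
    have h1 : L ≤ L ^ 2 := Nat.le_self_pow two_ne_zero L
    omega
  have hy0 : 0 ≤ y := by rw [hy, roughLevel]; positivity
  have hny : (n : ℝ) ≤ y := Nat.floor_le hy0
  have hylt : y < n + 1 := Nat.lt_floor_add_one y
  have hn0 : (0 : ℝ) < n := by exact_mod_cast (by omega : 0 < n)
  have hn3r : (3 : ℝ) ≤ n := by exact_mod_cast hn3
  have hc3 : (3 : ℝ) ≤ y := le_trans (by exact_mod_cast (by omega : 3 ≤ max (2 * L ^ 2) (2 * t) + 3)) hyc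
  have hl0 : 0 ≤ Real.log N := Real.log_nonneg hN1
  -- `log N ≥ 1` (indeed `√(log N) > 16`)
  have hu_lt : (roughExp N : ℝ) < Real.sqrt (Real.log N) + 1 := Nat.ceil_lt_add_one (Real.sqrt_nonneg _)
  have h17 : (17 : ℝ) ≤ (roughExp N : ℝ) := by exact_mod_cast hu17
  have hlogN1 : (1 : ℝ) ≤ Real.log N := by
    nlinarith [Real.sq_sqrt hl0, Real.sqrt_nonneg (Real.log N)]
  have hu1 : 1 ≤ u := le_trans (by norm_num) hu17
  have hu0 : (0 : ℝ) < u := by exact_mod_cast hu1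
  -- `log n ≤ log N` and `1 ≤ log n`
  have hyN : y ≤ N := by
    have h : (N : ℝ) ^ ((1 : ℝ) / u) ≤ (N : ℝ) ^ (1 : ℝ) :=
      Real.rpow_le_rpow_of_exponent_le hN1 ((div_le_one hu0).mpr (by exact_mod_cast hu1))
    rw [Real.rpow_one] at h
    exact h
  have hlognN : Real.log n ≤ Real.log N := Real.log_le_log hn0 (hny.trans hyN)
  have hlogn1 : (1 : ℝ) ≤ Real.log n := by
    rw [Real.le_log_iff_exp_le hn0]
    linarith [Real.exp_one_lt_three]
  have hlogn0 : 0 ≤ Real.log n := by linarith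
  -- the head numerics
  set H : ℝ := (Real.exp 5 * Real.log n) ^ t with hH
  set HN : ℝ := (Real.exp 5 * Real.log N) ^ t with hHN
  have hHle : H ≤ HN := pow_le_pow_left₀ (mul_nonneg (Real.exp_pos 5).le hlogn0)
    (mul_le_mul_of_nonneg_left hlognN (Real.exp_pos 5).le) t
  have hH1 : 1 ≤ H := by
    refine one_le_pow₀ ?_
    have he : (1 : ℝ) ≤ Real.exp 5 := Real.one_le_exp (by norm_num)
    exact one_le_mul_of_one_le_of_one_le he hlogn1
  have hHN0 : 0 ≤ HN := pow_nonneg (mul_nonneg (Real.exp_pos 5).le hl0) t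
  have hhead : HN ≤ ε * N := by
    have hq1 : (1 : ℝ) ≤ (N : ℝ) ^ ((1 : ℝ) / 4) := Real.one_le_rpow hN1 (by norm_num)
    calc HN = Real.exp 5 ^ t * Real.log N ^ t := by rw [hHN, mul_pow]
      _ ≤ Real.exp 5 ^ t * Real.log N ^ t * (N : ℝ) ^ ((1 : ℝ) / 4) :=
          le_mul_of_one_le_right (by positivity) hq1
      _ ≤ ε * N := hpol
  -- the tail numerics
  set R : ℝ := Real.log ((2 * L ^ 2 * N : ℕ) : ℝ) / Real.log n with hR
  have hHH : Real.log ((2 * L ^ 2 * N : ℕ) : ℝ) ≤ 2 * Real.log N := by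
    have h1 : ((2 * L ^ 2 * N : ℕ) : ℝ) ≤ N * N := by
      push_cast
      exact mul_le_mul_of_nonneg_right hNL (Nat.cast_nonneg N)
    have h2 : Real.log ((2 * L ^ 2 * N : ℕ) : ℝ) ≤ Real.log (N * N) := by
      rcases Nat.eq_zero_or_pos (2 * L ^ 2 * N) with h0 | hpos
      · rw [h0, Nat.cast_zero, Real.log_zero]
        exact Real.log_nonneg (by nlinarith)
      · exact Real.log_le_log (by exact_mod_cast hpos) h1
    rw [Real.log_mul hN0.ne' hN0.ne'] at h2
    linarith
  have hRle : R ≤ 2 * Real.log N :=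
    (div_le_self (Real.log_natCast_nonneg _) hlogn1).trans hHH
  have hR0 : 0 ≤ R := div_nonneg (Real.log_natCast_nonneg _) hlogn0
  -- `1/n ≤ 2/y ≤ 2 e^{-u/16}`
  have hexp : Real.exp ((1 : ℝ) / 16 * u) ≤ y := exp_roughExp_div_le_roughLevel hN1 hu17
  have h1n : 1 / (n : ℝ) ≤ 2 * Real.exp (-((1 : ℝ) / 16 * u)) := by
    have h1 : 1 / (n : ℝ) ≤ 2 / y := by
      rw [div_le_div_iff₀ hn0 (by linarith)]
      linarith
    have h2 : 1 / y ≤ 1 / Real.exp ((1 : ℝ) / 16 * u) := one_div_le_one_div_of_le (Real.exp_pos _) hexp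
    rw [one_div (Real.exp _), ← Real.exp_neg] at h2
    calc 1 / (n : ℝ) ≤ 2 / y := h1
      _ = 2 * (1 / y) := by ring
      _ ≤ 2 * Real.exp (-((1 : ℝ) / 16 * u)) := by linarith
  set σ : ℝ := (t : ℝ) ^ 2 / n + 4 * t / n * ((t : ℝ) ^ 2 * R) with hσ
  have hσle : σ ≤ ((t : ℝ) ^ 2 + 8 * (t : ℝ) ^ 3) * Real.log N * (2 * Real.exp (-((1 : ℝ) / 16 * u))) := by
    have ht0 : (0 : ℝ) ≤ t := Nat.cast_nonneg t
    calc σ ≤ (t : ℝ) ^ 2 / n + 4 * t / n * ((t : ℝ) ^ 2 * (2 * Real.log N)) := by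
          rw [hσ]
          gcongr
      _ = ((t : ℝ) ^ 2 + 8 * (t : ℝ) ^ 3 * Real.log N) * (1 / n) := by ring
      _ ≤ (((t : ℝ) ^ 2 + 8 * (t : ℝ) ^ 3) * Real.log N) * (2 * Real.exp (-((1 : ℝ) / 16 * u))) := by
          refine mul_le_mul ?_ h1n (by positivity) (by positivity)
          have h := mul_le_mul_of_nonneg_left hlogN1 (sq_nonneg (t : ℝ))
          linarith
  have hmain : 2 * σ * HN ≤ min ε 1 :=
    calc 2 * σ * HN ≤ 2 * (((t : ℝ) ^ 2 + 8 * (t : ℝ) ^ 3) * Real.log N *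
          (2 * Real.exp (-((1 : ℝ) / 16 * u)))) * HN :=
          mul_le_mul_of_nonneg_right (mul_le_mul_of_nonneg_left hσle (by norm_num)) hHN0
      _ = 4 * ((t : ℝ) ^ 2 + 8 * (t : ℝ) ^ 3) * Real.exp 5 ^ t * Real.log N ^ (t + 1) *
            Real.exp (-((1 : ℝ) / 16 * u)) := by
          rw [hHN, mul_pow, pow_succ]; ring
      _ ≤ min ε 1 := hdec
  have hσ0 : 0 ≤ σ := by rw [hσ]; positivity
  have hσH : 2 * σ * H ≤ min ε 1 :=
    (mul_le_mul_of_nonneg_left hHle (by positivity)).trans hmain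
  refine ⟨hNpos, le_trans (by norm_num) hn3, hnL, hnT, ?_, hσH.trans (min_le_left _ _), hHle.trans hhead⟩
  -- `σ ≤ 2 σ H ≤ 1`
  have : σ ≤ 2 * σ * H := by
    have h := mul_le_mul_of_nonneg_left hH1 hσ0
    linarith
  exact this.trans (hσH.trans (min_le_right _ _))

/-! ### The stub -/

/-- **Singular tail at the sieve level (`stub_singularTail`).** Uniformly over non-degenerate `Ψ` of `t`
forms with `‖Ψ‖_N ≤ L`: `|∏_{p ≤ ⌊y_N⌋} β_p(Ψ) − 𝔖(Ψ)| ≤ ε` and `∏_{p ≤ ⌊y_N⌋} β_p(Ψ) ≤ ε N` for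
`N ≥ N₀(t, L, ε)` (`y_N = N^{1/⌈√(log N)⌉}`). See the module docstring for the proof.
[cite: GreenTao2010, Lemma 1.3] -/
theorem stub_singularTail : SingularTailAtLevel := by
  intro t L ε hε
  obtain ⟨N₀, hN₀⟩ := exists_tailThreshold t L hε
  refine ⟨N₀, fun N hN Ψ hΨ hL => ?_⟩
  obtain ⟨hNpos, hn2, hnL, hnT, hσ1, hσε, hhead⟩ := hN₀ N hN
  set n : ℕ := ⌊roughLevel N⌋₊ with hn
  set σ : ℝ := (t : ℝ) ^ 2 / n + 4 * t / n * ((t : ℝ) ^ 2 *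
    (Real.log ((2 * L ^ 2 * N : ℕ) : ℝ) / Real.log n)) with hσ
  set H : ℝ := (Real.exp 5 * Real.log n) ^ t with hH
  have hP0 : 0 ≤ singularProductPartial Ψ n := Finset.prod_nonneg fun p _ => localFactor_nonneg Ψ p
  have hPH : singularProductPartial Ψ n ≤ H := singularProductPartial_le_log_pow Ψ hn2
  have hH0 : 0 ≤ H := hP0.trans hPH
  refine ⟨?_, hPH.trans hhead⟩
  have hσ0 : 0 ≤ σ := by rw [hσ]; positivity
  -- the tail estimate for every `x ≥ n`
  have htail : ∀ x : ℕ, n ≤ x →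
      |singularProductPartial Ψ x - singularProductPartial Ψ n| ≤ ε := by
    intro x hnx
    set Q := ∏ p ∈ Nat.primesLE x \ Nat.primesLE n, localFactor Ψ p with hQ
    have hsplit : singularProductPartial Ψ x = singularProductPartial Ψ n * Q := by
      unfold singularProductPartial
      rw [hQ, mul_comm, Finset.prod_sdiff (Nat.primesLE_mono hnx)]
    have hs : ∑ p ∈ Nat.primesLE x \ Nat.primesLE n, |localFactor Ψ p - 1| ≤ σ :=
      sum_abs_localFactor_sub_one_le Ψ hΨ hNpos hL hn2 hnL hnT x
    have h1 : |Q - 1| ≤ Real.exp (∑ p ∈ Nat.primesLE x \ Nat.primesLE n, |localFactor Ψ p - 1|) - 1 := by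
      have := Finset.norm_prod_one_add_sub_one_le (Nat.primesLE x \ Nat.primesLE n)
        (fun p => localFactor Ψ p - 1)
      simp only [add_sub_cancel, Real.norm_eq_abs] at this
      rw [hQ]
      exact this
    have h2 := Real.exp_le_exp.mpr hs
    have h3 : Real.exp σ - 1 ≤ 2 * σ := by
      have := Real.abs_exp_sub_one_le (x := σ) (by rwa [abs_of_nonneg hσ0])
      rw [abs_of_nonneg hσ0] at this
      exact (le_abs_self _).trans this
    have hQ1 : |Q - 1| ≤ 2 * σ := by linarith
    calc |singularProductPartial Ψ x - singularProductPartial Ψ n|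
        = |singularProductPartial Ψ n| * |Q - 1| := by
          rw [hsplit, ← abs_mul]
          ring_nf
      _ ≤ H * (2 * σ) := by
          rw [abs_of_nonneg hP0]
          exact mul_le_mul hPH hQ1 (abs_nonneg _) hH0
      _ = 2 * σ * H := by ring
      _ ≤ ε := hσε
  -- pass to the limit `x → ∞` (Lemma 1.3 for the non-degenerate system `Ψ`)
  have hlim : Tendsto (fun x => |singularProductPartial Ψ x - singularProductPartial Ψ n|) atTop
      (𝓝 |singularProduct Ψ - singularProductPartial Ψ n|) :=
    (continuous_abs.tendsto _).comp ((tendsto_singularProductPartial_holds 1 t Ψ hΨ).sub tendsto_const_nhds)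
  rw [abs_sub_comm]
  exact le_of_tendsto hlim (Filter.eventually_atTop.mpr ⟨n, htail⟩)

end Summit.Parity.GeneralizedHardyLittlewood.Cruxes.DimOne.BirthSieve

end
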